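import Summits.BirchSwinnertonDyer.BirchSwinnertonDyer.Theses.KatoDescentTamePotSupersingular
import Summits.BirchSwinnertonDyer.BirchSwinnertonDyer.Theorems.KatoDescentPotSupersingularReducibleKatoMemberLoadLine
import HarnessLib

/-!
# Route `KatoDescentTamePotSupersingular` (K8-t′), crux M `ReducibleKatoMember` (item stmt-BirchSwinnertonDyer-19196): the load
# line of the held child BY NAME — modulo {`PublishedInputNewformKatoZT`, `PublishedInputRankEqAnalyticRankZT`, Kato's
# Euler-system-existence fact} the held child `PublishedInputMemberHullZetaInputsT` ↔ `ReducibleKatoMember`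

Seat `bsd-potss-rkm` generation 14; typed (by-name) form of the route-free
`Theorems/KatoDescentPotSupersingularReducibleKatoMemberLoadLine.lean` (`ReducibleKatoMemberLoadLine.…`).  The route
aliases unfold by `rfl` to the Literature constants.  CONDITIONAL theorems; nothing is asserted or discharged; no
item closes; BSD is not advanced.  References: see the route-free file. [Kato2004Asterisque]
-/

set_option autoImplicit false
set_option linter.dupNamespace false

noncomputable section

open Literature.NumberTheory.EllipticCurves Literature.NumberTheory.EllipticCurves.Kato2004
open Summit.BirchSwinnertonDyer.BirchSwinnertonDyer.Theses.KatoDescentTamePotSupersingular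

namespace Summit.BirchSwinnertonDyer.BirchSwinnertonDyer.Theorems

/-- **K8-t′, crux M BY NAME: `PublishedInputMemberHullZetaInputsT ↔ ReducibleKatoMember` modulo the held inputs
`PublishedInputNewformKatoZT` (modularity), `PublishedInputRankEqAnalyticRankZT` (GZK) and Kato's Euler-system-existence
fact `Kato2004.exists_member_eulerSystem_expStar_values`** — the held child (KT twin of 20297) of item 19196 is, over the tree,
the crux itself plus Kato's construction (`ReducibleKatoMemberLoadLine.exists_memberHullZetaInputs_iff_katoMember`).
[cite: Kato2004Asterisque, Thm. 12.5 (1)–(3) (pp. 221–222), Thm. 12.6 (p. 222), 13.14 (p. 234), §14.14 (pp. 242–244), Prop. 14.16 (2) (p. 244)]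
[cite: Darmon2004, Thm. 3.22] [cite: DiamondShurman2005, Thm. 8.8.3] -/
theorem tamePublishedInputMemberHullZetaInputs_iff_reducibleKatoMember (hN : PublishedInputNewformKatoZT)
    (hG : PublishedInputRankEqAnalyticRankZT) (hZ0 : Kato2004.exists_member_eulerSystem_expStar_values) :
    PublishedInputMemberHullZetaInputsT ↔ ReducibleKatoMember :=
  ReducibleKatoMemberLoadLine.exists_memberHullZetaInputs_iff_katoMember hN hG hZ0

/-- **K8-t′: the held child FROM the crux** — `ReducibleKatoMember → PublishedInputMemberHullZetaInputsT` given GZK and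
Kato's Euler-system-existence fact (the converse of the closed glue `ReducibleKatoMemberOfZetaInputsT`, item 20300).
[cite: Kato2004Asterisque, Thm. 12.6 (p. 222), 13.14 (p. 234), §14.14 (p. 243), Prop. 14.16 (2) (p. 244)] [cite: Darmon2004, Thm. 3.22] -/
theorem tamePublishedInputMemberHullZetaInputs_of_reducibleKatoMember (hG : PublishedInputRankEqAnalyticRankZT)
    (hZ0 : Kato2004.exists_member_eulerSystem_expStar_values) (hM : ReducibleKatoMember) :
    PublishedInputMemberHullZetaInputsT :=
  ReducibleKatoMemberLoadLine.exists_memberHullZetaInputs_of_eulerSystem_of_katoMember hZ0 hG hM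

end Summit.BirchSwinnertonDyer.BirchSwinnertonDyer.Theorems

end
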